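import Summits.MatrixMultiplication.MatrixMultiplication.Theorems.AbelianSTPPCensusShapeCertVPDefs

/-!
# Abelian STPP census — kernel evaluation of the vP certificate checker `ShapeCertVP` (D: orders 230–254)

Cell mm-stpp, route `AbelianSTPPCensusVP`, crux `ShapeExclusionVP337` (stmt-MatrixMultiplication-19191); support file
(no definitions).  `ShapeCertVP.checkV M = true` by `decide +kernel` (no `native_decide`, standard axioms), ONE theorem
per order so that every kernel evaluation starts with empty caches (measured in the seat folder: ≈ 4–8 s per order below
300, ≤ 35 s at the orders 300–337 — candidate-list construction plus the `feasP` packings of the visited nodes);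
`Elab.async false` keeps the evaluations of this file sequential (one kernel computation in memory at a time; tree
precedent `NeelSignC23EK0Cert4`).  The range lemma `checkV_230_254` at the end collects the file; the ten ranges are
assembled on `128 ≤ M ≤ 337` in `AbelianSTPPCensusVPShapeExclusionVP337.lean`, where `ShapeCertVP.checkV_sound`
(`…ShapeCertVPSearch`) and the bridge `ShapeCertVP.shapeExclusionVP_of_checkV` (`…ShapeCertVPFinal`) turn them into
the crux.
-/

set_option linter.dupNamespace false -- `MatrixMultiplication.MatrixMultiplication` (summit = problem, D-0017)
set_option autoImplicit false
set_option Elab.async false -- sequential kernel evaluations (memory high-water of one order at a time)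

namespace Summit.MatrixMultiplication.MatrixMultiplication.Theorems.ShapeCertVP

set_option maxHeartbeats 0 in
/-- certificate check at order `230` (kernel evaluation) -/
theorem checkV_230 : checkV 230 = true := by
  decide +kernel

set_option maxHeartbeats 0 in
/-- certificate check at order `231` (kernel evaluation) -/
theorem checkV_231 : checkV 231 = true := by
  decide +kernel

set_option maxHeartbeats 0 in
/-- certificate check at order `232` (kernel evaluation) -/
theorem checkV_232 : checkV 232 = true := by
  decide +kernel

set_option maxHeartbeats 0 in
/-- certificate check at order `233` (kernel evaluation) -/
theorem checkV_233 : checkV 233 = true := by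
  decide +kernel

set_option maxHeartbeats 0 in
/-- certificate check at order `234` (kernel evaluation) -/
theorem checkV_234 : checkV 234 = true := by
  decide +kernel

set_option maxHeartbeats 0 in
/-- certificate check at order `235` (kernel evaluation) -/
theorem checkV_235 : checkV 235 = true := by
  decide +kernel

set_option maxHeartbeats 0 in
/-- certificate check at order `236` (kernel evaluation) -/
theorem checkV_236 : checkV 236 = true := by
  decide +kernel

set_option maxHeartbeats 0 in
/-- certificate check at order `237` (kernel evaluation) -/
theorem checkV_237 : checkV 237 = true := by
  decide +kernel

set_option maxHeartbeats 0 in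
/-- certificate check at order `238` (kernel evaluation) -/
theorem checkV_238 : checkV 238 = true := by
  decide +kernel

set_option maxHeartbeats 0 in
/-- certificate check at order `239` (kernel evaluation) -/
theorem checkV_239 : checkV 239 = true := by
  decide +kernel

set_option maxHeartbeats 0 in
/-- certificate check at order `240` (kernel evaluation) -/
theorem checkV_240 : checkV 240 = true := by
  decide +kernel

set_option maxHeartbeats 0 in
/-- certificate check at order `241` (kernel evaluation) -/
theorem checkV_241 : checkV 241 = true := by
  decide +kernel

set_option maxHeartbeats 0 in
/-- certificate check at order `242` (kernel evaluation) -/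
theorem checkV_242 : checkV 242 = true := by
  decide +kernel

set_option maxHeartbeats 0 in
/-- certificate check at order `243` (kernel evaluation) -/
theorem checkV_243 : checkV 243 = true := by
  decide +kernel

set_option maxHeartbeats 0 in
/-- certificate check at order `244` (kernel evaluation) -/
theorem checkV_244 : checkV 244 = true := by
  decide +kernel

set_option maxHeartbeats 0 in
/-- certificate check at order `245` (kernel evaluation) -/
theorem checkV_245 : checkV 245 = true := by
  decide +kernel

set_option maxHeartbeats 0 in
/-- certificate check at order `246` (kernel evaluation) -/
theorem checkV_246 : checkV 246 = true := by
  decide +kernel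

set_option maxHeartbeats 0 in
/-- certificate check at order `247` (kernel evaluation) -/
theorem checkV_247 : checkV 247 = true := by
  decide +kernel

set_option maxHeartbeats 0 in
/-- certificate check at order `248` (kernel evaluation) -/
theorem checkV_248 : checkV 248 = true := by
  decide +kernel

set_option maxHeartbeats 0 in
/-- certificate check at order `249` (kernel evaluation) -/
theorem checkV_249 : checkV 249 = true := by
  decide +kernel

set_option maxHeartbeats 0 in
/-- certificate check at order `250` (kernel evaluation) -/
theorem checkV_250 : checkV 250 = true := by
  decide +kernel

set_option maxHeartbeats 0 in
/-- certificate check at order `251` (kernel evaluation) -/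
theorem checkV_251 : checkV 251 = true := by
  decide +kernel

set_option maxHeartbeats 0 in
/-- certificate check at order `252` (kernel evaluation) -/
theorem checkV_252 : checkV 252 = true := by
  decide +kernel

set_option maxHeartbeats 0 in
/-- certificate check at order `253` (kernel evaluation) -/
theorem checkV_253 : checkV 253 = true := by
  decide +kernel

set_option maxHeartbeats 0 in
/-- certificate check at order `254` (kernel evaluation) -/
theorem checkV_254 : checkV 254 = true := by
  decide +kernel

/-- **The vP certificate holds at every order `230 ≤ M ≤ 254`** (collects the evaluations of this file). -/
theorem checkV_230_254 (M : ℕ) (h₁ : 230 ≤ M) (h₂ : M ≤ 254) : checkV M = true := by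
  interval_cases M
  · exact checkV_230
  · exact checkV_231
  · exact checkV_232
  · exact checkV_233
  · exact checkV_234
  · exact checkV_235
  · exact checkV_236
  · exact checkV_237
  · exact checkV_238
  · exact checkV_239
  · exact checkV_240
  · exact checkV_241
  · exact checkV_242
  · exact checkV_243
  · exact checkV_244
  · exact checkV_245
  · exact checkV_246
  · exact checkV_247
  · exact checkV_248
  · exact checkV_249
  · exact checkV_250
  · exact checkV_251
  · exact checkV_252
  · exact checkV_253
  · exact checkV_254

end Summit.MatrixMultiplication.MatrixMultiplication.Theorems.ShapeCertVP
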